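import Mathlib.Data.ZMod.Basic
import Mathlib.Data.List.ProdSigma
import Summits.MatrixMultiplication.OmegaCensus.BoxAlphaS3Cert2

/-!
# The box constant `α_{S₃}(6,3,3) ≤ 10` (kernel certificate) and the census cells it closes

ω-census, family (b3); census row NR138 (box bound, `ProductBoxBound.lean`), first α-instance (pub-omega lit g17 on
the lead's ask 2026-08-23T08:42:59Z).  Framing: lottery ticket; floor = certified bounds/negative ranges.

**Theorem (`volume_le_ten_mul_card`).**  Let `A` be a finite abelian group and `(S, T, U)` a TPP triple of
`S₃ × A` (`S₃ = Equiv.Perm (Fin 3)`) with `|T| ≤ 3` and `|U| ≤ 3`.  Then `|S|·|T|·|U| ≤ 10·|A|`.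
Hence (`not_realizesTPP_S3_prod`) `S₃ × A` realizes no `⟨N₁, 3, 3⟩` with `9 N₁ > 10 |A|`; instances: `(32,3,3)` in
`S₃ × C₂₈` and in `S₃ × C₂ × C₁₄` (`288 > 280`), `(35,3,3)` in `S₃ × C₃₁` (`315 > 310`) — the tpp lane's cells
"(32,3,3) UNSAT in AG-168-11 and AG-168-12 (S₃ part)" and "(35,3,3) UNSAT in AG-186-3" (sr-tpp-search-g15 FAT-THEORY.md §1.1,
there script-certified as `α_{S₃}(6,3,3) = 10`), now kernel-checked.

*Proof.*  `ProductBoxBound.box_bound` with `k = 10` needs: every set of cells `I ⊆ X × Y × W` (`Y, W` the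
`S₃`-projections of `T, U`, so `|Y|, |W| ≤ 3`) that is independent (`cellWord P P' ≠ 1` for `P ≠ P'` in `I`) has
`|I| ≤ 10`.  The map `(a, b, c) ↦ (x a x⁻¹, x b y₀⁻¹ x⁻¹, x c w₀⁻¹ x⁻¹)` (`y₀ ∈ Y`, `w₀ ∈ W`, `x ∈ S₃`) conjugates
cell words (`cellWord_transport`), so it carries `I` to an independent set of the same size inside
`S₃ × Y' × W'` with `1 ∈ Y', W'`, `|Y'|, |W'| ≤ 3`; a kernel enumeration (`covering`) shows that for a suitable `x`
this box lies inside one of 19 representative boxes (`BoxAlphaS3Cert1/2.lean`) `S₃ × Yᵢ × Wᵢ` (`|Yᵢ| = |Wᵢ| = 3`; one per orbit of the 100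
normalised boxes under simultaneous conjugation), and for each representative the verified branch-and-bound of
`IndepSetBound.lean` (`srch`, clique-cover pruning with a 12-clique cover found by an ILP, kit job j190574;
soundness `card_lt_of_chk_of_srch`) refutes an independent 11-set by `decide +kernel` (`srchᵢ`, 316 254 search
nodes in total), the dictionary between cells and vertex numbers being checked by `decide` as well (`dictᵢ`,
`chkᵢ`).  In 99 of the 100 boxes an independent 10-set exists (lane data), so `10` is the true constant. ∎

Elementary new mathematics of the cell (a finite computation made kernel-checkable); not a published statement.
-/


open Finset Equiv
open Literature.Computability.AlgebraicComplexity (RealizesTPP)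
open Summit.MatrixMultiplication.OmegaCensus.ProductBoxBound (cellWord box_bound)
open Summit.MatrixMultiplication.OmegaCensus.IndepSetBound (chk srch card_lt_of_chk_of_srch)

-- the kernel computations below must not run concurrently (memory): elaborate sequentially
set_option Elab.async false

namespace Summit.MatrixMultiplication.OmegaCensus.BoxAlphaS3

/-! ### Covering and transport -/

/-- the 16 normalised supports: subsets of `S₃` containing `1` with at most three elements -/
def normsets : List (Finset Q) :=
  [{1},
  {1, s12},
  {1, s01},
  {1, s01 * s12},
  {1, s12 * s01},
  {1, s02},
  {1, s12, s01},
  {1, s12, s01 * s12},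
  {1, s12, s12 * s01},
  {1, s12, s02},
  {1, s01, s01 * s12},
  {1, s01, s12 * s01},
  {1, s01, s02},
  {1, s01 * s12, s12 * s01},
  {1, s01 * s12, s02},
  {1, s12 * s01, s02}]

/-- Every subset of `S₃` containing `1` with at most three elements is one of the 16 `normsets`
(kernel enumeration). -/
theorem mem_normsets : ∀ Y' ∈ (Finset.univ : Finset Q).powerset, 1 ∈ Y' → #Y' ≤ 3 → Y' ∈ normsets := by
  decide +kernel

/-- Every pair of normalised supports is carried by a simultaneous conjugation into one of the 19
representative boxes (kernel enumeration). -/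
theorem covering : ∀ p ∈ List.product normsets normsets,
    ∃ x : Q, ∃ b ∈ reps, (∀ y ∈ p.1, x * y * x⁻¹ ∈ b.1) ∧ (∀ w ∈ p.2, x * w * x⁻¹ ∈ b.2) := by
  decide +kernel

/-- The transport map on cells: translate the `Y`- and `W`-coordinates, then conjugate everything by `x`. -/
def transport (x y₀ w₀ : Q) (P : Q × Q × Q) : Q × Q × Q :=
  (x * P.1 * x⁻¹, x * (P.2.1 * y₀⁻¹) * x⁻¹, x * (P.2.2 * w₀⁻¹) * x⁻¹)

/-- Cell words are conjugated by the transport map. -/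
theorem cellWord_transport (x y₀ w₀ : Q) (P P' : Q × Q × Q) :
    cellWord (transport x y₀ w₀ P) (transport x y₀ w₀ P') = x * cellWord P P' * x⁻¹ := by
  simp only [cellWord, transport, mul_inv_rev, inv_inv]
  group

/-- The transport map is injective. -/
theorem transport_injective (x y₀ w₀ : Q) : Function.Injective (transport x y₀ w₀) := by
  intro P P' h
  simp only [transport, Prod.mk.injEq] at h
  obtain ⟨h1, h2, h3⟩ := h
  refine Prod.ext ?_ (Prod.ext ?_ ?_)
  · simpa using h1
  · simpa using h2
  · simpa using h3

/-- **`α_{S₃}(6,3,3) ≤ 10` in the form `box_bound` needs**: for finite `Y, W ⊆ S₃` with at most three elements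
each, every independent cell set inside `X × Y × W` has at most 10 cells. -/
theorem indep_card_le_ten (X Y W : Finset Q) (hY : #Y ≤ 3) (hW : #W ≤ 3) (I : Finset (Q × Q × Q))
    (hI : I ⊆ X ×ˢ (Y ×ˢ W)) (hind : ∀ P ∈ I, ∀ P' ∈ I, P ≠ P' → cellWord P P' ≠ 1) : #I ≤ 10 := by
  classical
  by_cases hIe : I = ∅
  · simp [hIe]
  obtain ⟨P₀, hP₀⟩ := Finset.nonempty_iff_ne_empty.mpr hIe
  have hP₀' := Finset.mem_product.mp (hI hP₀)
  have hy₀ : P₀.2.1 ∈ Y := (Finset.mem_product.mp hP₀'.2).1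
  have hw₀ : P₀.2.2 ∈ W := (Finset.mem_product.mp hP₀'.2).2
  set y₀ := P₀.2.1
  set w₀ := P₀.2.2
  -- normalised supports
  set Y' := Y.image (· * y₀⁻¹) with hY'
  set W' := W.image (· * w₀⁻¹) with hW'
  have h1Y : (1 : Q) ∈ Y' := Finset.mem_image.mpr ⟨y₀, hy₀, mul_inv_cancel y₀⟩
  have h1W : (1 : Q) ∈ W' := Finset.mem_image.mpr ⟨w₀, hw₀, mul_inv_cancel w₀⟩
  have hY'c : #Y' ≤ 3 := Finset.card_image_le.trans hY
  have hW'c : #W' ≤ 3 := Finset.card_image_le.trans hW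
  obtain ⟨x, b, hb, hbY, hbW⟩ := covering (Y', W') (List.pair_mem_product.mpr
    ⟨mem_normsets Y' (Finset.mem_powerset.mpr (Finset.subset_univ _)) h1Y hY'c,
      mem_normsets W' (Finset.mem_powerset.mpr (Finset.subset_univ _)) h1W hW'c⟩)
  -- transport `I` into the representative box `b`
  set F := transport x y₀ w₀ with hF
  have hFI : I.image F ⊆ Finset.univ ×ˢ (b.1.toFinset ×ˢ b.2.toFinset) := by
    intro P hP
    obtain ⟨P₁, hP₁, rfl⟩ := Finset.mem_image.mp hP
    have hm := Finset.mem_product.mp (hI hP₁)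
    have hm2 := Finset.mem_product.mp hm.2
    simp only [Finset.mem_product, Finset.mem_univ, true_and, List.mem_toFinset, hF, transport]
    refine ⟨?_, ?_⟩
    · have := hbY (P₁.2.1 * y₀⁻¹) (Finset.mem_image.mpr ⟨P₁.2.1, hm2.1, rfl⟩)
      simpa [mul_assoc] using this
    · have := hbW (P₁.2.2 * w₀⁻¹) (Finset.mem_image.mpr ⟨P₁.2.2, hm2.2, rfl⟩)
      simpa [mul_assoc] using this
  have hFind : ∀ P ∈ I.image F, ∀ P' ∈ I.image F, P ≠ P' → cellWord P P' ≠ 1 := by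
    intro P hP P' hP' hne
    obtain ⟨P₁, hP₁, rfl⟩ := Finset.mem_image.mp hP
    obtain ⟨P₁', hP₁', rfl⟩ := Finset.mem_image.mp hP'
    have hne' : P₁ ≠ P₁' := fun h => hne (by rw [h])
    rw [hF, cellWord_transport]
    intro h1
    apply hind P₁ hP₁ P₁' hP₁' hne'
    have : x⁻¹ * (x * cellWord P₁ P₁' * x⁻¹) * x = x⁻¹ * 1 * x := by rw [h1]
    simpa [mul_assoc] using this
  have hcard : #(I.image F) = #I := Finset.card_image_of_injective I (transport_injective x y₀ w₀)
  rw [← hcard]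
  exact geom_of_mem_reps b hb (I.image F) hFI hFind

variable {A : Type*} [CommGroup A] [Fintype A] [DecidableEq A]

/-- **Theorem.** For every TPP triple `(S, T, U)` of `S₃ × A` (`A` finite abelian) with `|T| ≤ 3` and `|U| ≤ 3`:
`|S|·|T|·|U| ≤ 10·|A|`. -/
theorem volume_le_ten_mul_card (S T U : Finset (Q × A))
    (h : Literature.Combinatorics.Additive.TripleProductProperty S T U) (hT : #T ≤ 3) (hU : #U ≤ 3) :
    #S * #T * #U ≤ 10 * Fintype.card A :=
  box_bound S T U h 10 fun I hI hind =>
    indep_card_le_ten (S.image Prod.fst) (T.image Prod.fst) (U.image Prod.fst)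
      (Finset.card_image_le.trans hT) (Finset.card_image_le.trans hU) I hI hind

/-- Corollary: `S₃ × A` does not realize `⟨N₁, 3, 3⟩` when `10 |A| < 9 N₁`. -/
theorem not_realizesTPP_S3_prod (N₁ : ℕ) (hlt : 10 * Fintype.card A < N₁ * 3 * 3) :
    ¬ RealizesTPP (Q × A) N₁ 3 3 := by
  rintro ⟨S, T, U, hS, hT, hU, h⟩
  have := volume_le_ten_mul_card S T U h hT.le hU.le
  rw [hS, hT, hU] at this
  omega

/-- `(32, 3, 3)` is not realized by `S₃ × C₂₈` (`288 > 280`; tpp-lane cell of AG-168-12, S₃-part). -/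
theorem S3xC28_no_tpp_32_3_3 : ¬ RealizesTPP (Q × Multiplicative (ZMod 28)) 32 3 3 :=
  not_realizesTPP_S3_prod 32 (by simp)

/-- `(32, 3, 3)` is not realized by `S₃ × C₂ × C₁₄` (`288 > 280`; tpp-lane cell of AG-168-11). -/
theorem S3xC2xC14_no_tpp_32_3_3 :
    ¬ RealizesTPP (Q × (Multiplicative (ZMod 2) × Multiplicative (ZMod 14))) 32 3 3 :=
  not_realizesTPP_S3_prod 32 (by simp)

/-- `(35, 3, 3)` is not realized by `S₃ × C₃₁` (`315 > 310`; tpp-lane cell of AG-186-3). -/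
theorem S3xC31_no_tpp_35_3_3 : ¬ RealizesTPP (Q × Multiplicative (ZMod 31)) 35 3 3 :=
  not_realizesTPP_S3_prod 35 (by simp)

end Summit.MatrixMultiplication.OmegaCensus.BoxAlphaS3
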